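import Summits.PneNP.PneNP.Theorems.OneSliceShallowSliceBoundSlices
import Summits.PneNP.PneNP.Theorems.OneSliceSliceACZeroBinomialHazard

/-!
# Route OneSlice, item `ShallowSliceBound` (stmt-PneNP-14083): random sub-cubes as a binomial mixture of slices

Helper file (prover seat, 2026-08-16), def-free (vocabulary: `wt`, `sliceAvg`, `binomPMF` of
`Theorems/OneSliceSliceACZeroDefs.lean`). For a cube `ι → Bool` (`N = |ι|`), a set `T ⊆ ι` of coordinates and
`y`, the SUB-CUBE POINT `y ∧ 1_T` is `fun e => if e ∈ T then y e else false`. Averaging over all `T` of size `r`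
and all `y` produces each point `x` exactly `C(N - |x|, r - |x|) · 2^{N-r}` times (`sum_card_fiber_eq`), so the
law of `y ∧ 1_T` is the `Bin(r, 1/2)`-mixture of the uniform measures on the slices:

* `sum_card_subcube_eq_sum_slices` — `Σ_{|T|=r} #{y : P(y ∧ 1_T)} = Σ_ℓ #{x : |x| = ℓ, P x} · mult(r, ℓ)`;
* `sum_slices_mult_eq` — `Σ_{ℓ ∈ S} #slice_ℓ · mult(r,ℓ) = C(N,r) 2^N Σ_{ℓ ∈ S} Bin(r,1/2)(ℓ)`;
* `subcube_sum_le` / `le_subcube_sum` — for MONOTONE `g` (non-decreasing slice averages, `…Slices.lean`):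
  `Σ_{|T|=r} #{y : g(y ∧ 1_T)} ≤ C(N,r)2^N (a_j(g) + Pr[Bin(r,½) > j])` and
  `≥ C(N,r)2^N · a_t(g) (1 - Pr[Bin(r,½) < t])`.
-/

set_option linter.dupNamespace false

noncomputable section

namespace Summit.PneNP.PneNP.Theorems.ShallowSliceBound

open Finset
open Summit.PneNP.PneNP.Cruxes.SliceACZero.RussoWindowLadder (wt sliceAvg binomPMF binomPMF_nonneg)
open Summit.PneNP.PneNP.Cruxes.SliceACZero.RussoWindowLadder.BinomialHazard (sum_binomPMF binomPMF_eq_zero_of_lt)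
open Literature.Combinatorics.SetFamily (finsetEquivFun mem_finsetEquivFun_symm)

variable {ι : Type} [Fintype ι] [DecidableEq ι]

/-! ### Fibres of `(T, y) ↦ y ∧ 1_T` -/

/-- The fibre over a point supported inside `T` has `2^{N - |T|}` elements (the coordinates off `T` are free).
[folklore] -/
theorem card_fiber_subcube (T : Finset ι) (x : ι → Bool) (hx : ∀ e, x e = true → e ∈ T) :
    #(univ.filter fun y : ι → Bool => (fun e => if e ∈ T then y e else false) = x) =
      2 ^ (Fintype.card ι - #T) := by
  have hc : #((univ \ T).powerset) = 2 ^ (Fintype.card ι - #T) := by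
    rw [card_powerset, card_sdiff_of_subset (subset_univ T), card_univ]
  rw [← hc]
  refine card_bij' (fun y _ => (finsetEquivFun.symm y) \ T)
    (fun Z _ => fun e => if e ∈ T then x e else decide (e ∈ Z)) ?_ ?_ ?_ ?_
  · intro y _
    rw [mem_powerset]
    exact sdiff_subset_sdiff (subset_univ _) subset_rfl
  · intro Z hZ
    rw [mem_powerset] at hZ
    simp only [mem_filter, mem_univ, true_and]
    funext e
    by_cases he : e ∈ T
    · simp [he]
    · simp only [he, if_false]
      by_contra hxe
      have : x e = true := by
        revert hxe; cases x e <;> simp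
      exact he (hx e this)
  · intro y hy
    simp only [mem_filter, mem_univ, true_and] at hy
    funext e
    by_cases he : e ∈ T
    · have := congrFun hy e
      simp only [he, if_true] at this
      simp [he, this]
    · simp [he]
  · intro Z hZ
    rw [mem_powerset] at hZ
    ext e
    simp only [mem_sdiff, mem_finsetEquivFun_symm]
    by_cases he : e ∈ T
    · simp only [he, if_true, not_true, and_false, false_iff]
      intro heZ
      have := hZ heZ
      simp [he] at this
    · simp [he]

/-- The fibre over a point NOT supported inside `T` is empty. [folklore] -/
theorem card_fiber_subcube_eq_zero (T : Finset ι) (x : ι → Bool) {e : ι} (hxe : x e = true) (he : e ∉ T) :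
    #(univ.filter fun y : ι → Bool => (fun e => if e ∈ T then y e else false) = x) = 0 := by
  rw [card_eq_zero, filter_eq_empty_iff]
  intro y _ hy
  have := congrFun hy e
  simp only [he, if_false] at this
  rw [hxe] at this
  exact Bool.false_ne_true this

/-- **Multiplicity of a point under random sub-cubes**: summed over all `T` of size `r`, the point `x` is hit
`C(N - |x|, r - |x|) · 2^{N-r}` times if `|x| ≤ r`, and never otherwise. [folklore] -/
theorem sum_card_fiber_eq (r : ℕ) (x : ι → Bool) :
    ∑ T ∈ powersetCard r (univ : Finset ι),
        #(univ.filter fun y : ι → Bool => (fun e => if e ∈ T then y e else false) = x) =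
      if wt x ≤ r then (Fintype.card ι - wt x).choose (r - wt x) * 2 ^ (Fintype.card ι - r) else 0 := by
  set S := finsetEquivFun.symm x with hS
  have hwt : wt x = #S := rfl
  have key : ∀ T ∈ powersetCard r (univ : Finset ι),
      #(univ.filter fun y : ι → Bool => (fun e => if e ∈ T then y e else false) = x) =
        if S ⊆ T then 2 ^ (Fintype.card ι - r) else 0 := by
    intro T hT
    rw [mem_powersetCard] at hT
    split_ifs with hST
    · rw [card_fiber_subcube T x fun e he => hST (by simpa [hS] using he), hT.2]
    · rw [not_subset] at hST
      obtain ⟨e, heS, heT⟩ := hST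
      exact card_fiber_subcube_eq_zero T x (by simpa [hS] using heS) heT
  rw [sum_congr rfl key, ← sum_filter, sum_const, smul_eq_mul]
  split_ifs with hr
  · rw [hwt] at hr ⊢
    rw [Finset.card_filter_powersetCard_subset S univ r (subset_univ S) hr, card_univ]
  · have : (powersetCard r (univ : Finset ι)).filter (fun T => S ⊆ T) = ∅ := by
      rw [filter_eq_empty_iff]
      intro T hT hST
      rw [mem_powersetCard] at hT
      have := card_le_card hST
      rw [← hwt, hT.2] at this
      exact hr this
    rw [this, card_empty, zero_mul]

/-! ### Sub-cube sums as slice mixtures -/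

/-- **Random sub-cubes are a mixture of slices**: for every property `P`,
`Σ_{|T|=r} #{y : P(y ∧ 1_T)} = Σ_{ℓ ≤ N} #{x : |x| = ℓ, P x} · mult(r, ℓ)` with
`mult(r, ℓ) = [ℓ ≤ r] C(N-ℓ, r-ℓ) 2^{N-r}`. [folklore] -/
theorem sum_card_subcube_eq_sum_slices (r : ℕ) (P : (ι → Bool) → Prop) [DecidablePred P] :
    ∑ T ∈ powersetCard r (univ : Finset ι),
        #(univ.filter fun y : ι → Bool => P (fun e => if e ∈ T then y e else false)) =
      ∑ ℓ ∈ range (Fintype.card ι + 1), #(univ.filter fun x : ι → Bool => wt x = ℓ ∧ P x) *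
        (if ℓ ≤ r then (Fintype.card ι - ℓ).choose (r - ℓ) * 2 ^ (Fintype.card ι - r) else 0) := by
  -- fibrewise in `x`, then swap
  have h1 : ∀ T ∈ powersetCard r (univ : Finset ι),
      #(univ.filter fun y : ι → Bool => P (fun e => if e ∈ T then y e else false)) =
        ∑ x ∈ univ.filter P, #(univ.filter fun y : ι → Bool => (fun e => if e ∈ T then y e else false) = x) := by
    intro T _
    rw [card_eq_sum_card_fiberwise (f := fun y : ι → Bool => (fun e => if e ∈ T then y e else false))
      (t := univ.filter P) (fun y hy => by simpa using hy)]
    refine sum_congr rfl fun x _ => ?_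
    congr 1
    ext y
    simp only [mem_filter, mem_univ, true_and, and_iff_right_iff_imp]
    intro h; rw [h]; simpa using (mem_filter.1 ‹x ∈ univ.filter P›).2
  rw [sum_congr rfl h1, sum_comm]
  simp only [sum_card_fiber_eq]
  -- group the `x` by weight
  symm
  rw [← sum_fiberwise_of_maps_to (s := univ.filter P) (t := range (Fintype.card ι + 1)) (g := fun x => wt x)
    (fun x _ => by
      rw [mem_range]
      exact Nat.lt_succ_of_le (by
        rw [wt, ← card_univ (α := ι)]; exact card_filter_le _ _))]
  refine sum_congr rfl fun ℓ _ => ?_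
  rw [sum_filter]
  have : ∀ x ∈ univ.filter P, (if wt x = ℓ then
      (if wt x ≤ r then (Fintype.card ι - wt x).choose (r - wt x) * 2 ^ (Fintype.card ι - r) else 0) else 0) =
      if wt x = ℓ then (if ℓ ≤ r then (Fintype.card ι - ℓ).choose (r - ℓ) * 2 ^ (Fintype.card ι - r) else 0)
        else 0 := by
    intro x _
    by_cases h : wt x = ℓ
    · subst h; rfl
    · rw [if_neg h, if_neg h]
  rw [sum_congr rfl this, ← sum_filter, sum_const, smul_eq_mul, filter_filter]
  congr 2
  ext x; simp [and_comm]

/-- **The slice weights are binomial**: `Σ_{ℓ ∈ S} #slice_ℓ · mult(r, ℓ) = C(N,r) 2^N Σ_{ℓ ∈ S} Bin(r,1/2)(ℓ)`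
(`C(N,ℓ) C(N-ℓ, r-ℓ) = C(N,r) C(r,ℓ)`), for `r ≤ N`. [folklore] -/
theorem sum_slices_mult_eq {r : ℕ} (hr : r ≤ Fintype.card ι) (S : Finset ℕ) :
    ((∑ ℓ ∈ S, #(univ.filter fun x : ι → Bool => wt x = ℓ) *
        (if ℓ ≤ r then (Fintype.card ι - ℓ).choose (r - ℓ) * 2 ^ (Fintype.card ι - r) else 0) : ℕ) : ℝ) =
      ((Fintype.card ι).choose r : ℝ) * 2 ^ Fintype.card ι * ∑ ℓ ∈ S, binomPMF r (1 / 2) ℓ := by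
  set N := Fintype.card ι with hN
  rw [Nat.cast_sum, mul_sum]
  refine sum_congr rfl fun ℓ _ => ?_
  rw [card_slice_eq_choose]
  split_ifs with hℓ
  · have hmul : N.choose ℓ * (N - ℓ).choose (r - ℓ) = N.choose r * r.choose ℓ := (Nat.choose_mul hℓ).symm
    have hmulR : (N.choose ℓ : ℝ) * ((N - ℓ).choose (r - ℓ) : ℝ) = (N.choose r : ℝ) * (r.choose ℓ : ℝ) := by
      exact_mod_cast hmul
    have hpow : (2 : ℝ) ^ N = 2 ^ (N - r) * 2 ^ r := by rw [← pow_add]; congr 1; omega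
    have h3 : (2 : ℝ) ^ N * ((1 / 2) ^ ℓ * (1 / 2) ^ (r - ℓ)) = 2 ^ (N - r) := by
      rw [← pow_add, Nat.add_sub_cancel' hℓ, hpow, mul_assoc, ← mul_pow]; norm_num
    rw [binomPMF, show (1 : ℝ) - 1 / 2 = 1 / 2 by norm_num]
    push_cast
    calc (N.choose ℓ : ℝ) * (((N - ℓ).choose (r - ℓ) : ℝ) * 2 ^ (N - r))
        = ((N.choose ℓ : ℝ) * ((N - ℓ).choose (r - ℓ) : ℝ)) * 2 ^ (N - r) := by ring
      _ = (N.choose r : ℝ) * (r.choose ℓ : ℝ) * (2 ^ N * ((1 / 2) ^ ℓ * (1 / 2) ^ (r - ℓ))) := by rw [hmulR, h3]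
      _ = _ := by ring
  · push Not at hℓ
    rw [binomPMF, Nat.choose_eq_zero_of_lt hℓ]
    simp

/-- The total number of pairs `(T, y)`: `Σ_{|T| = r} 2^N = C(N,r) 2^N`, in the mixture form. [folklore] -/
theorem sum_slices_mult_univ {r : ℕ} (hr : r ≤ Fintype.card ι) :
    ((∑ ℓ ∈ range (Fintype.card ι + 1), #(univ.filter fun x : ι → Bool => wt x = ℓ) *
        (if ℓ ≤ r then (Fintype.card ι - ℓ).choose (r - ℓ) * 2 ^ (Fintype.card ι - r) else 0) : ℕ) : ℝ) =
      ((Fintype.card ι).choose r : ℝ) * 2 ^ Fintype.card ι := by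
  rw [sum_slices_mult_eq hr]
  have : ∑ ℓ ∈ range (Fintype.card ι + 1), binomPMF r (1 / 2) ℓ = ∑ ℓ ∈ range (r + 1), binomPMF r (1 / 2) ℓ := by
    symm
    refine sum_subset (range_subset_range.2 (by omega)) fun ℓ hℓ hℓr => ?_
    rw [mem_range] at hℓ hℓr
    exact binomPMF_eq_zero_of_lt r _ (by omega)
  rw [this, sum_binomPMF, mul_one]

/-! ### The two sandwich inequalities for monotone `g` -/

/-- **Upper sandwich**: for monotone `g`, `r ≤ N` and `j ≤ N`,
`Σ_{|T|=r} #{y : g(y ∧ 1_T)} ≤ C(N,r) 2^N · (a_j(g) + Pr[Bin(r,½) > j])`. [folklore] -/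
theorem subcube_sum_le {g : (ι → Bool) → Bool} (hg : Monotone g) {r j : ℕ} (hr : r ≤ Fintype.card ι)
    (hj : j ≤ Fintype.card ι) :
    ((∑ T ∈ powersetCard r (univ : Finset ι),
        #(univ.filter fun y : ι → Bool => g (fun e => if e ∈ T then y e else false) = true) : ℕ) : ℝ) ≤
      ((Fintype.card ι).choose r : ℝ) * 2 ^ Fintype.card ι *
        (sliceAvg g j + ∑ ℓ ∈ Ioc j r, binomPMF r (1 / 2) ℓ) := by
  set N := Fintype.card ι with hN
  set mult : ℕ → ℕ := fun ℓ => if ℓ ≤ r then (N - ℓ).choose (r - ℓ) * 2 ^ (N - r) else 0 with hmult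
  rw [sum_card_subcube_eq_sum_slices r (fun x => g x = true)]
  -- split the levels at `j`
  have hsplit : range (N + 1) = (range (N + 1)).filter (fun ℓ => ℓ ≤ j) ∪ (range (N + 1)).filter (fun ℓ => ¬ ℓ ≤ j) :=
    (filter_union_filter_not_eq _ _).symm
  rw [hsplit, sum_union (disjoint_filter_filter_not _ _ _), Nat.cast_add]
  have hslice_pos : (0 : ℝ) < #(univ.filter fun x : ι → Bool => wt x = j) := by exact_mod_cast card_slice_pos hj
  -- low levels: `acc_ℓ ≤ a_j · slice_ℓ`
  have hlow : (((∑ ℓ ∈ (range (N + 1)).filter (fun ℓ => ℓ ≤ j),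
      #(univ.filter fun x : ι → Bool => wt x = ℓ ∧ g x = true) * mult ℓ) : ℕ) : ℝ) ≤
      sliceAvg g j * (((∑ ℓ ∈ (range (N + 1)).filter (fun ℓ => ℓ ≤ j),
        #(univ.filter fun x : ι → Bool => wt x = ℓ) * mult ℓ) : ℕ) : ℝ) := by
    push_cast
    rw [mul_sum]
    refine sum_le_sum fun ℓ hℓ => ?_
    rw [mem_filter] at hℓ
    have hmono := card_acc_mul_le hg hℓ.2 hj
    rw [sliceAvg]
    have hm0 : (0 : ℝ) ≤ (mult ℓ : ℝ) := Nat.cast_nonneg _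
    rw [div_mul_eq_mul_div, le_div_iff₀ hslice_pos]
    calc (#(univ.filter fun x : ι → Bool => wt x = ℓ ∧ g x = true) : ℝ) * (mult ℓ : ℝ) *
          #(univ.filter fun x : ι → Bool => wt x = j)
        = (#(univ.filter fun x : ι → Bool => wt x = ℓ ∧ g x = true) : ℝ) *
            #(univ.filter fun x : ι → Bool => wt x = j) * mult ℓ := by ring
      _ ≤ (#(univ.filter fun x : ι → Bool => wt x = j ∧ g x = true) : ℝ) *
            #(univ.filter fun x : ι → Bool => wt x = ℓ) * mult ℓ := mul_le_mul_of_nonneg_right hmono hm0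
      _ = _ := by ring
  have htot : (((∑ ℓ ∈ (range (N + 1)).filter (fun ℓ => ℓ ≤ j),
        #(univ.filter fun x : ι → Bool => wt x = ℓ) * mult ℓ) : ℕ) : ℝ) ≤ (N.choose r : ℝ) * 2 ^ N := by
    rw [← sum_slices_mult_univ hr]
    exact_mod_cast sum_le_sum_of_subset_of_nonneg (filter_subset _ _) fun _ _ _ => Nat.zero_le _
  -- high levels: `acc_ℓ ≤ slice_ℓ`, then the binomial tail
  have hhigh : (((∑ ℓ ∈ (range (N + 1)).filter (fun ℓ => ¬ ℓ ≤ j),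
      #(univ.filter fun x : ι → Bool => wt x = ℓ ∧ g x = true) * mult ℓ) : ℕ) : ℝ) ≤
      (N.choose r : ℝ) * 2 ^ N * ∑ ℓ ∈ Ioc j r, binomPMF r (1 / 2) ℓ := by
    have h1 : (∑ ℓ ∈ (range (N + 1)).filter (fun ℓ => ¬ ℓ ≤ j),
        #(univ.filter fun x : ι → Bool => wt x = ℓ ∧ g x = true) * mult ℓ) ≤
        ∑ ℓ ∈ (range (N + 1)).filter (fun ℓ => ¬ ℓ ≤ j), #(univ.filter fun x : ι → Bool => wt x = ℓ) * mult ℓ :=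
      sum_le_sum fun ℓ _ => Nat.mul_le_mul_right _ (card_acc_le_card_slice g ℓ)
    have h2 := sum_slices_mult_eq hr ((range (N + 1)).filter (fun ℓ => ¬ ℓ ≤ j))
    have h3 : ∑ ℓ ∈ (range (N + 1)).filter (fun ℓ => ¬ ℓ ≤ j), binomPMF r (1 / 2) ℓ ≤
        ∑ ℓ ∈ Ioc j r, binomPMF r (1 / 2) ℓ := by
      have hnn : ∀ ℓ, 0 ≤ binomPMF r (1 / 2) ℓ := fun ℓ =>
        binomPMF_nonneg r (by norm_num) (by norm_num) ℓ
      -- terms with `ℓ > r` vanish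
      have hz : ∀ ℓ ∈ (range (N + 1)).filter (fun ℓ => ¬ ℓ ≤ j), ℓ ∉ Ioc j r → binomPMF r (1 / 2) ℓ = 0 := by
        intro ℓ hℓ hℓ'
        rw [mem_filter, mem_range] at hℓ
        rw [mem_Ioc, not_and_or] at hℓ'
        rcases hℓ' with h | h
        · omega
        · exact binomPMF_eq_zero_of_lt r _ (by omega)
      calc ∑ ℓ ∈ (range (N + 1)).filter (fun ℓ => ¬ ℓ ≤ j), binomPMF r (1 / 2) ℓ
          = ∑ ℓ ∈ ((range (N + 1)).filter (fun ℓ => ¬ ℓ ≤ j)).filter (fun ℓ => ℓ ∈ Ioc j r), binomPMF r (1 / 2) ℓ +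
            ∑ ℓ ∈ ((range (N + 1)).filter (fun ℓ => ¬ ℓ ≤ j)).filter (fun ℓ => ¬ ℓ ∈ Ioc j r), binomPMF r (1 / 2) ℓ :=
            (sum_filter_add_sum_filter_not _ _ _).symm
        _ = ∑ ℓ ∈ ((range (N + 1)).filter (fun ℓ => ¬ ℓ ≤ j)).filter (fun ℓ => ℓ ∈ Ioc j r), binomPMF r (1 / 2) ℓ := by
            rw [sum_eq_zero (fun ℓ hℓ => hz ℓ (mem_filter.1 hℓ).1 (mem_filter.1 hℓ).2), add_zero]
        _ ≤ ∑ ℓ ∈ Ioc j r, binomPMF r (1 / 2) ℓ :=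
            sum_le_sum_of_subset_of_nonneg (fun ℓ hℓ => (mem_filter.1 hℓ).2) fun ℓ _ _ => hnn ℓ
    calc (((∑ ℓ ∈ (range (N + 1)).filter (fun ℓ => ¬ ℓ ≤ j),
          #(univ.filter fun x : ι → Bool => wt x = ℓ ∧ g x = true) * mult ℓ) : ℕ) : ℝ)
        ≤ ((∑ ℓ ∈ (range (N + 1)).filter (fun ℓ => ¬ ℓ ≤ j), #(univ.filter fun x : ι → Bool => wt x = ℓ) * mult ℓ : ℕ) : ℝ) := by
          exact_mod_cast h1
      _ = (N.choose r : ℝ) * 2 ^ N * ∑ ℓ ∈ (range (N + 1)).filter (fun ℓ => ¬ ℓ ≤ j), binomPMF r (1 / 2) ℓ := h2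
      _ ≤ _ := mul_le_mul_of_nonneg_left h3 (by positivity)
  have ha := sliceAvg_nonneg g j
  calc _ ≤ sliceAvg g j * ((N.choose r : ℝ) * 2 ^ N) + (N.choose r : ℝ) * 2 ^ N * ∑ ℓ ∈ Ioc j r, binomPMF r (1 / 2) ℓ :=
        add_le_add (hlow.trans (mul_le_mul_of_nonneg_left htot ha)) hhigh
    _ = _ := by ring

/-- **Lower sandwich**: for monotone `g`, `r ≤ N` and `t ≤ N`,
`C(N,r) 2^N · a_t(g) · (1 - Pr[Bin(r,½) < t]) ≤ Σ_{|T|=r} #{y : g(y ∧ 1_T)}`. [folklore] -/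
theorem le_subcube_sum {g : (ι → Bool) → Bool} (hg : Monotone g) {r t : ℕ} (hr : r ≤ Fintype.card ι)
    (ht : t ≤ Fintype.card ι) :
    ((Fintype.card ι).choose r : ℝ) * 2 ^ Fintype.card ι *
        (sliceAvg g t * (1 - ∑ ℓ ∈ range t, binomPMF r (1 / 2) ℓ)) ≤
      ((∑ T ∈ powersetCard r (univ : Finset ι),
        #(univ.filter fun y : ι → Bool => g (fun e => if e ∈ T then y e else false) = true) : ℕ) : ℝ) := by
  set N := Fintype.card ι with hN
  set mult : ℕ → ℕ := fun ℓ => if ℓ ≤ r then (N - ℓ).choose (r - ℓ) * 2 ^ (N - r) else 0 with hmult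
  rw [sum_card_subcube_eq_sum_slices r (fun x => g x = true)]
  have hslice_pos : (0 : ℝ) < #(univ.filter fun x : ι → Bool => wt x = t) := by exact_mod_cast card_slice_pos ht
  -- keep only the levels `ℓ ≥ t`
  have hsub : (((∑ ℓ ∈ (range (N + 1)).filter (fun ℓ => t ≤ ℓ),
      #(univ.filter fun x : ι → Bool => wt x = ℓ ∧ g x = true) * mult ℓ) : ℕ) : ℝ) ≤
      ((∑ ℓ ∈ range (N + 1), #(univ.filter fun x : ι → Bool => wt x = ℓ ∧ g x = true) * mult ℓ : ℕ) : ℝ) := by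
    exact_mod_cast sum_le_sum_of_subset_of_nonneg (filter_subset _ _) fun _ _ _ => Nat.zero_le _
  refine le_trans ?_ hsub
  -- on levels `ℓ ≥ t`: `a_t · slice_ℓ ≤ acc_ℓ`
  have hhigh : sliceAvg g t * (((∑ ℓ ∈ (range (N + 1)).filter (fun ℓ => t ≤ ℓ),
        #(univ.filter fun x : ι → Bool => wt x = ℓ) * mult ℓ) : ℕ) : ℝ) ≤
      (((∑ ℓ ∈ (range (N + 1)).filter (fun ℓ => t ≤ ℓ),
        #(univ.filter fun x : ι → Bool => wt x = ℓ ∧ g x = true) * mult ℓ) : ℕ) : ℝ) := by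
    push_cast
    rw [mul_sum]
    refine sum_le_sum fun ℓ hℓ => ?_
    rw [mem_filter, mem_range] at hℓ
    have hmono := card_acc_mul_le hg hℓ.2 (by omega : ℓ ≤ Fintype.card ι)
    rw [sliceAvg]
    have hm0 : (0 : ℝ) ≤ (mult ℓ : ℝ) := Nat.cast_nonneg _
    rw [div_mul_eq_mul_div, div_le_iff₀ hslice_pos]
    calc (#(univ.filter fun x : ι → Bool => wt x = t ∧ g x = true) : ℝ) *
          ((#(univ.filter fun x : ι → Bool => wt x = ℓ) : ℝ) * (mult ℓ : ℝ))
        = (#(univ.filter fun x : ι → Bool => wt x = t ∧ g x = true) : ℝ) *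
            #(univ.filter fun x : ι → Bool => wt x = ℓ) * mult ℓ := by ring
      _ ≤ (#(univ.filter fun x : ι → Bool => wt x = ℓ ∧ g x = true) : ℝ) *
            #(univ.filter fun x : ι → Bool => wt x = t) * mult ℓ := mul_le_mul_of_nonneg_right hmono hm0
      _ = _ := by ring
  refine le_trans ?_ hhigh
  -- the mass of the levels `ℓ ≥ t` is `C(N,r)2^N (1 - Pr[Bin < t])`
  have hmass : (((∑ ℓ ∈ (range (N + 1)).filter (fun ℓ => t ≤ ℓ),
      #(univ.filter fun x : ι → Bool => wt x = ℓ) * mult ℓ) : ℕ) : ℝ) =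
      (N.choose r : ℝ) * 2 ^ N * (1 - ∑ ℓ ∈ range t, binomPMF r (1 / 2) ℓ) := by
    have h1 := sum_slices_mult_univ (ι := ι) hr
    have h2 := sum_slices_mult_eq (ι := ι) hr (range t)
    have hsplit : range (N + 1) = range t ∪ (range (N + 1)).filter (fun ℓ => t ≤ ℓ) := by
      ext ℓ; simp only [mem_union, mem_range, mem_filter]; omega
    have hdisj : Disjoint (range t) ((range (N + 1)).filter (fun ℓ => t ≤ ℓ)) := by
      rw [disjoint_left]; intro ℓ h1 h2
      rw [mem_range] at h1; rw [mem_filter] at h2; omega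
    rw [hsplit, sum_union hdisj, Nat.cast_add] at h1
    rw [h2] at h1
    linear_combination h1
  rw [hmass]
  have ha := sliceAvg_nonneg g t
  nlinarith [mul_nonneg (mul_nonneg (Nat.cast_nonneg (N.choose r)) (pow_nonneg (by norm_num : (0:ℝ) ≤ 2) N)) ha]

/-- **Registered form** (sub-goal `subcube_upper_sandwich` of stmt-PneNP-14083): the upper sandwich, all binders
explicit. [folklore] -/
theorem subcube_upper_sandwich :
    ∀ (ι : Type) [Fintype ι] [DecidableEq ι] (g : (ι → Bool) → Bool), Monotone g → ∀ r j : ℕ, r ≤ Fintype.card ι →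
      j ≤ Fintype.card ι →
      ((∑ T ∈ powersetCard r (univ : Finset ι),
        #(univ.filter fun y : ι → Bool => g (fun e => if e ∈ T then y e else false) = true) : ℕ) : ℝ) ≤
      ((Fintype.card ι).choose r : ℝ) * 2 ^ Fintype.card ι * (sliceAvg g j + ∑ ℓ ∈ Ioc j r, binomPMF r (1 / 2) ℓ) :=
  fun _ _ _ _ hg _ _ hr hj => subcube_sum_le hg hr hj

end Summit.PneNP.PneNP.Theorems.ShallowSliceBound

end
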